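import Summits.Ventures.CertifiedManyBodySolver.Downfold.WorkedExamplePassDome

/-!
# Cell-word precedence for the router's `CI` annotation: the ROUTER's consumer default vs ACCEPTANCE §3.3 R-2W

Venture CertifiedManyBodySolver, cell `pub/hubbard-downfold`, seat hubbard-downfold-score-2 (session g8,
2026-08-27T05:0xZ); namespace `Summit.Ventures.CertifiedManyBodySolver.Downfold.CellWord`. Everything here is a
finite, PROVED statement about two published TEXTS; nothing is about a material's physics.

WHAT THIS IS NOT: not the scorer of record (deputy-2 `score.py` v1.8 90fa3153c4e6faab), not the assembler of record
(oracle-dag `assemble1.py` 0.4.7/0.4.8), not a ruling. It is the kernel reference for the DECISION ITEM the downfold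
lead's ruling R-ai (2) (2026-08-27T04:28Z) put on «deputy-2 + score-2 under ACCEPTANCE», and for regression scenario
S95 (`validation/score/regression/v1`, suite v1.8.2):

* READING R (ROUTER.md v0.6.4 §3 l.38, pre-routing text, the lead's R-ai (2)): where the annotation `CI` is printed,
  «consumers default EVERY cell to «not (Mott/CT insulator at commensurate filling), screening-grade»» — under ANY
  primary word (`routerDefault`).
* READING A (ACCEPTANCE v1.8 §3.3 R-2W (a) «the PRIMARY alone governs the cell word» + (c) «NEVER for primary
  UND:MULTIORB, UND:HF, UND:DISPUTED, UND:STRUCT, UND:MIXED: … the cell stays «undetermined (router:UND:…)» and the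
  scorer flags any such «not» (W9) while scoring it as issued»; assembler 0.4.5+): `CI` writes the «not» default only
  under a primary OFF the never-list (`acceptanceDefault`), and a «not» under a never-list primary draws `w9`.
* READING A′ (the NARROW v1.9 amendment score-2 docketed 04:4xZ, not in force): as A, except that `CI` also licenses
  the default under primary `UND:MIXED` (the U-school straddle: CI fired under every admitted school) — never under
  the four structure/orbital never-list primaries (`amendedDefault`).

PROVED: R and A coincide off the never-list and differ exactly on (never-list primary, CI present)
(`differ_iff`); A′ differs from A exactly at (UND:MIXED, CI) and agrees with R there (`amended_eq_acceptance_iff`,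
`amended_undMixed_ci`); the four cells of record — M13 La₂CuO₄ BEFORE the R-y re-route («1BH+3BE+CI»: «not» under
all three), M13 AFTER («UND:MIXED+…+CI»: R «not» / A undetermined + W9 on the R shape / A′ «not»), LK-99 M30
(«UND:DISPUTED+UND:FLAT+CI»: R «not» / A and A′ undetermined — its road to «not» is §3.3 (d)'s ENVELOPE, not CI),
M58 Ca₂CuO₂Cl₂ («1BH+3BE+CI»: «not» under all three); and the material-verdict consequence on a known
non-superconductor column: all-undetermined ⇒ ABSTAIN, all-«not» ⇒ TN (`kindOf`), which is the RUN #10 → RUN #11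
movement of M13 (TN → ABSTAIN) that golden S94 records and that A′ or an A10 re-route to «1BH+3BE+CI» would undo.
-/

namespace Summit.Ventures.CertifiedManyBodySolver.Downfold

namespace CellWord

open CellScore (Kind)

/-- The router heads that can stand as PRIMARY word (ROUTER.md v0.6.4 §3 / ACCEPTANCE §2.1 code grammar; the open
`UND:<TAG>` family is represented by the tags the never-list and the FLAT override name). [folklore] -/
inductive Primary
  | EPH | OneBH | ThreeBE | BI | CI | UND_FLAT | UND_MIXED | UND_MULTIORB | UND_HF | UND_DISPUTED | UND_STRUCT
  | UND_OTHER
  deriving DecidableEq, Repr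

/-- What a consumer reads off a router word for the DEFAULT cell word: the primary head and whether the annotation
`CI` (commensurate correlated insulator expected) is printed among the words. [folklore] -/
structure Header where
  primary : Primary
  ci : Bool
  deriving DecidableEq, Repr

/-- The default cell word a consumer writes BEFORE any S2/S3/e–ph hand-in decides the cell: «undetermined» (with a
reason) or «not, screening-grade». [folklore] -/
inductive Default
  | undetermined | notScreening
  deriving DecidableEq, Repr

/-- ACCEPTANCE §3.3 R-2W (c)'s NEVER-list: primaries under which an «undetermined → not» upgrade is never licensed
(«there an e–ph-only «not» on a known superconductor is exactly the miss the router pre-declared»; deputy-2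
ACCEPTANCE.md v1.8 §3.3 (c)). [folklore] -/
def Primary.onNeverList : Primary → Bool
  | .UND_MULTIORB | .UND_HF | .UND_DISPUTED | .UND_STRUCT | .UND_MIXED => true
  | _ => false

/-- primaries that are themselves an insulator code: `BI` (band insulator) and a bare `CI`; both texts default
their cells to «not». [folklore] -/
def Primary.insulatorCode : Primary → Bool
  | .BI | .CI => true
  | _ => false

/-- READING R (ROUTER.md §3 l.38; lead R-ai (2)): `CI` printed ⇒ «not, screening-grade» on every cell, under ANY
primary; an insulator-code primary likewise; otherwise undetermined (ROUTER.md v0.6.4 §3 l.38). [folklore] -/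
def routerDefault (h : Header) : Default :=
  if h.ci || h.primary.insulatorCode then .notScreening else .undetermined

/-- READING A (ACCEPTANCE §3.3 R-2W (a)+(c); assembler 0.4.5+): the primary governs; `CI` writes the «not» default
only under a primary OFF the never-list (deputy-2 ACCEPTANCE.md v1.8 §3.3). [folklore] -/
def acceptanceDefault (h : Header) : Default :=
  if h.primary.insulatorCode || (h.ci && !h.primary.onNeverList) then .notScreening else .undetermined

/-- W9 (ACCEPTANCE §3.3 (c), both engines of record): a «not» cell under a never-list primary is FLAGGED (and scored
as issued; deputy-2 ACCEPTANCE.md v1.8 §3.3 (c) «the scorer flags any such «not» (W9)»). [folklore] -/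
def w9 (h : Header) (d : Default) : Bool :=
  decide (d = .notScreening) && h.primary.onNeverList

/-- READING A′ (score-2's docketed NARROW v1.9 amendment, NOT in force): as A, plus `CI` licenses the default under
primary `UND:MIXED` (and under no other never-list primary). [folklore] -/
def amendedDefault (h : Header) : Default :=
  if h.primary.insulatorCode || (h.ci && (!h.primary.onNeverList || decide (h.primary = .UND_MIXED))) then
    .notScreening else .undetermined

/-! ## The two texts coincide off the never-list and differ exactly on (never-list primary, CI) -/

/-- Off the never-list the router's consumer default and ACCEPTANCE's precedence write the same cell. [folklore] -/
theorem agree_off_neverList (h : Header) (hn : h.primary.onNeverList = false) :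
    routerDefault h = acceptanceDefault h := by
  cases h with
  | mk p c => cases p <;> cases c <;> simp_all [routerDefault, acceptanceDefault, Primary.onNeverList,
      Primary.insulatorCode]

/-- The readings differ EXACTLY when `CI` is printed under a never-list primary; there R writes «not» and A writes
«undetermined». [folklore] -/
theorem differ_iff (h : Header) :
    routerDefault h ≠ acceptanceDefault h ↔ (h.ci = true ∧ h.primary.onNeverList = true) := by
  cases h with
  | mk p c => cases p <;> cases c <;> decide

/-- … and on every such header the router-shape cell draws W9 under the yardstick of record. [folklore] -/
theorem w9_on_router_shape (h : Header) (hc : h.ci = true) (hn : h.primary.onNeverList = true) :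
    routerDefault h = .notScreening ∧ acceptanceDefault h = .undetermined ∧ w9 h (routerDefault h) = true := by
  cases h with
  | mk p c => cases p <;> cases c <;> simp_all [routerDefault, acceptanceDefault, w9, Primary.onNeverList,
      Primary.insulatorCode]

/-- ACCEPTANCE's own default never draws W9 (it never writes «not» under a never-list primary). [folklore] -/
theorem w9_acceptance_false (h : Header) : w9 h (acceptanceDefault h) = false := by
  cases h with
  | mk p c => cases p <;> cases c <;> decide

/-! ## The narrow amendment A′ -/

/-- A′ agrees with A except exactly at (UND:MIXED, CI). [folklore] -/
theorem amended_eq_acceptance_iff (h : Header) :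
    amendedDefault h = acceptanceDefault h ↔ ¬ (h.primary = .UND_MIXED ∧ h.ci = true) := by
  cases h with
  | mk p c => cases p <;> cases c <;> decide

/-- … where it writes the router's «not». [folklore] -/
theorem amended_undMixed_ci : amendedDefault ⟨.UND_MIXED, true⟩ = .notScreening ∧
    routerDefault ⟨.UND_MIXED, true⟩ = .notScreening ∧ acceptanceDefault ⟨.UND_MIXED, true⟩ = .undetermined := by
  decide

/-- A′ keeps the four structure/orbital never-list primaries undetermined even with `CI`. [folklore] -/
theorem amended_keeps_structure_never (p : Primary) (hp : p.onNeverList = true) (hm : p ≠ .UND_MIXED) :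
    amendedDefault ⟨p, true⟩ = .undetermined := by
  cases p <;> simp_all [amendedDefault, Primary.onNeverList, Primary.insulatorCode]

/-! ## The cells of record -/

/-- M13 La₂CuO₄ @0 BEFORE the R-y re-route (RUN #3…#10 word «1BH+3BE+CI»). [folklore] -/
def m13Before : Header := ⟨.OneBH, true⟩
/-- M13 La₂CuO₄ @0 AFTER the re-route (v1.9 word «UND:MIXED+1BH+3BE+EPH+CI», RUN #11). [folklore] -/
def m13After : Header := ⟨.UND_MIXED, true⟩
/-- M30 LK-99 @0 («UND:DISPUTED+UND:FLAT(…)+CI»: structure status outranks the model descriptors). [folklore] -/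
def lk99 : Header := ⟨.UND_DISPUTED, true⟩
/-- M58 Ca₂CuO₂Cl₂ @0 (v2, «1BH+3BE+CI», decided TN in RUN #10/#11). [folklore] -/
def m58 : Header := ⟨.OneBH, true⟩

/-- M13 before: «not» under all three readings (no W9) — the TN of RUN #3…#10. [folklore] -/
theorem m13Before_all : routerDefault m13Before = .notScreening ∧ acceptanceDefault m13Before = .notScreening ∧
    amendedDefault m13Before = .notScreening ∧ w9 m13Before .notScreening = false := by decide

/-- M13 after: R «not» (W9-flagged under v1.8 — regression S95: TN scored as issued + W9 ×22), A «undetermined»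
(golden S94: ABSTAIN), A′ «not». [folklore] -/
theorem m13After_split : routerDefault m13After = .notScreening ∧ acceptanceDefault m13After = .undetermined ∧
    amendedDefault m13After = .notScreening ∧ w9 m13After .notScreening = true := by decide

/-- LK-99: only R writes «not»; A and A′ leave it undetermined (its «not» comes by §3.3 (d)'s ENVELOPE over the
disputed structure candidates, not by `CI`). [folklore] -/
theorem lk99_split : routerDefault lk99 = .notScreening ∧ acceptanceDefault lk99 = .undetermined ∧
    amendedDefault lk99 = .undetermined := by decide

/-- M58: «not» under all three (primary 1BH off the never-list). [folklore] -/
theorem m58_all : routerDefault m58 = .notScreening ∧ acceptanceDefault m58 = .notScreening ∧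
    amendedDefault m58 = .notScreening := by decide

/-! ## Material-verdict consequence on a known non-superconductor column (ACCEPTANCE §4.5) -/

/-- The §4.5 verdict kind of a known-nonSC material whose cells all carry the same default: all undetermined ⇒
ABSTAIN; all «not» ⇒ TN (no false positive is possible from a «not»). [folklore] -/
def kindOf : Default → Kind
  | .undetermined => .ABSTAIN
  | .notScreening => .TN

/-- M13 under the yardstick of record: TN before the re-route, ABSTAIN after (RUN #10 decided 3/59 → RUN #11 2/59;
golden S94's registered alternative branch). [folklore] -/
theorem m13_kind_acceptance :
    kindOf (acceptanceDefault m13Before) = .TN ∧ kindOf (acceptanceDefault m13After) = .ABSTAIN := by decide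

/-- … and the two roads back to TN: the narrow amendment A′ on the v1.9 word, or a re-route of the family to a 1BH
primary with `CI` (an adopted A10 treatment) under the unchanged text A. [folklore] -/
theorem m13_kind_roads_back :
    kindOf (amendedDefault m13After) = .TN ∧ kindOf (acceptanceDefault ⟨.OneBH, true⟩) = .TN := by decide

/-- An ABSTAIN among the six La-214 kinds keeps the §14 worked-example-2 09-09 test from PASSING whatever the
prerequisites and the dome (`WorkedExample.stage2_ne_PASS_of_ABSTAIN`): under reading A the re-routed M13 alone
already does that. [folklore] -/
theorem stage2_blocked_by_m13After (pre : Bool) (ks : List Kind) (d : WorkedExample.Dome)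
    (h : kindOf (acceptanceDefault m13After) ∈ ks) : WorkedExample.stage2 pre ks d ≠ .PASS := by
  have : kindOf (acceptanceDefault m13After) = .ABSTAIN := by decide
  rw [this] at h
  exact WorkedExample.stage2_ne_PASS_of_ABSTAIN h

end CellWord

end Summit.Ventures.CertifiedManyBodySolver.Downfold
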